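import Summits.QuantumFields.YangMills.Theorems.IR.AfPincerUcTypChain
import HarnessLib

/-!
# Crux `IR` (stmt-QuantumFields-19354), line `af-pincer-Uc`: the R107-compliant LANE-A supplier statement in the SHARP currency —
# the format's free `Typ` instantiated at the short-chain class `TypChain` (LEAD ym-lead-19354-af-pincer g2)

Helper module for item `stmt-QuantumFields-19354` (`--supports stmt-QuantumFields-19354 --as helper`; it closes nothing).

Owner R107∕R109: every supplier of `stub_onsetSharpSC : SharpOnset.OnsetSharpUKPcSC` must NAME a cell-local, INSERTION-TOLERANT typical
class.  `SharpLanes.TypChain ρ θ w ℓ₀` (no `θ`-bad chain of extent `≥ ℓ₀` among the cell's inner plaquettes) is cell-local, measurable and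
insertion tolerant (`typLocal_typChain`, `insertionTolerant_typChain`, p537603).  This file states the lane-A supplier statement OF THAT CLASS —
the (6b)-analogue of cplan's `WorkingClassSharpSC` for an R107-compliant class — and proves the one-line composition to I♯_SC and to the route decl:

* `TypChainSharpSC`: for every simply connected compact simple `G`, `r`, positive unit `a → 0` with `LowerBounds G r a`: admissible `(n, ε)`,
  a badness threshold `θ` and a tolerated extent `ℓ₀`, and for every budget `δ > 0` a window `T` such that for all large `β` SOME mesh
  `b ≥ 1` with `a β · b < T` carries, on every mesh-`b` frame, clause (i) at every centre, clause (ii) in UKP form and clause (iii) FOR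
  `TypChain ρ θ w ℓ₀`.
* `onsetSharpUKPcSC_of_typChainSharpSC : TypChainSharpSC → SharpOnset.OnsetSharpUKPcSC`; `ir_of_typChainSharpSC : … → IRNSC → IR`.
* §2 (cplan g18 located caveat on hulls): the OWN-PLAQUETTE guard variant `InsertionTolerantOwn` (cleanliness asked only of the cell's OWN
  plaquettes near `P` — a premise read off `cellEdges w c`, so hulls built with it stay `TypLocal`), `InsertionTolerant.of_own` (own-guard
  tolerance is the STRONGER property) and `insertionTolerantOwn_typChain` (the short-chain class passes it too, same constants).

LOCATED CONTENT of the three conjuncts (LEAD's reading): (ii)∕(iii) = a COLLAR-TYPICAL PEIERLS bound on long bad chains at the mesh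
`b ≍ 1/a` (the tree's any-exterior large-field lemma `IRKernelLargeField.kernel_measureReal_le_actionIn_le_of_subset` is boundary-dominated
for thin sets and does not give it; M/L; LEAD's located warning [heur]: take the badness threshold `θ` close to the maximal frustration
`2N` — for small `θ` a `TypChain`-typical neighbour may carry a dense dust of isolated single-link twists (short chains, allowed once `ℓ₀ > 2`)
that frustrates the mixed layer and pushes the cell's boundary-adjacent inner plaquettes above a small `θ`, so (ii) would fail); (i) = mixing at
the centre cell for collars carrying sparse short bad chains (R107 (c)) = the open weak-coupling content.  `hlb` is consumed at the mesh choice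
(director №132 (2)).

HONEST FRAMING: a named statement and two one-line compositions among OPEN statements of a CONDITIONAL chain (Track A 0/28 UV); nothing
here proves weak-coupling mixing or a gap; not Clay.  No `sorry`; axioms ⊆ {propext, Classical.choice, Quot.sound}.
-/

set_option autoImplicit false

noncomputable section

open Filter Topology MeasureTheory
open Literature.MathematicalPhysics.QuantumFieldTheory hiding ZdEdge
open Literature.MathematicalPhysics.QuantumLattice
open Summit.QuantumFields.YangMills.Cruxes.OSLegsFromFemtoAndGap.DlrCollarTransfer (LowerBounds)

namespace Summit.QuantumFields.YangMills.Cruxes.IR.AfPincerUc.SharpLanes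

open Summit.QuantumFields.YangMills.Cruxes.IR.AfPincerUc

/-- **Lane-A supplier statement for the short-chain class (R107-compliant, SHARP currency).**  See the module docstring. -/
def TypChainSharpSC : Prop :=
  ∀ (G : Type) [Group G] [TopologicalSpace G] [IsTopologicalGroup G] [CompactSpace G],
    IsCompactSimpleLieGroup G → SimplyConnectedSpace G →
    letI : MeasurableSpace G := borel G; haveI : BorelSpace G := ⟨rfl⟩;
    ∀ (r : LatticeRep G) (a : ℝ → ℝ), (∀ β, 0 < a β) → Tendsto a atTop (𝓝 0) → LowerBounds G r a →
      ∃ (n : ℕ) (ε : ℝ) (θ : ℝ) (ℓ₀ : ℕ), 1 ≤ n ∧ 0 ≤ ε ∧ ε * OnsetFormats.shellCount n ≤ 3 / 4 ∧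
        ∀ δ : ℝ, 0 < δ → ∃ T β₂ : ℝ, ∀ β : ℝ, β₂ ≤ β → ∃ b : ℕ, 1 ≤ b ∧ a β * (b : ℝ) < T ∧
          ∀ w : Fin 4 → ℤ → ℤ, IsFrame b w →
            ClauseIAll r.ρ β w n ε (TypChain r.ρ θ w ℓ₀) ∧ ClauseIIukp r.ρ β w δ (TypChain r.ρ θ w ℓ₀) ∧
              ClauseIII r.ρ β w b δ (TypChain r.ρ θ w ℓ₀)

/-- **`TypChainSharpSC` ⇒ I♯_SC (PROVED)** — instantiate the format's `∃ Typ` at `TypChain r.ρ θ w ℓ₀` (`typLocal_typChain`). -/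
theorem onsetSharpUKPcSC_of_typChainSharpSC (h : TypChainSharpSC) : SharpOnset.OnsetSharpUKPcSC := by
  intro G _ _ _ _ hG hsc
  letI : MeasurableSpace G := borel G
  haveI : BorelSpace G := ⟨rfl⟩
  intro r a ha hat hlb
  haveI : T2Space G := T2Space.of_injective_continuous r.injective r.continuous
  haveI : SecondCountableTopology G :=
    (r.continuous.isClosedEmbedding r.injective).isEmbedding.secondCountableTopology
  obtain ⟨n, ε, θ, ℓ₀, hn, hε, hM, hrest⟩ := h G hG hsc r a ha hat hlb
  refine ⟨n, ε, hn, hε, hM, fun δ hδ => ?_⟩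
  obtain ⟨T, β₂, hβ⟩ := hrest δ hδ
  refine ⟨T, β₂, fun β hb => ?_⟩
  obtain ⟨b, hb1, hlt, hw⟩ := hβ β hb
  refine ⟨b, hb1, hlt, fun w hwf => ?_⟩
  obtain ⟨hI, hII, hIII⟩ := hw w hwf
  exact ⟨TypChain r.ρ θ w ℓ₀, typLocal_typChain r.ρ r.continuous θ w ℓ₀, hI, hII, hIII⟩

/-- **`TypChainSharpSC` ∧ residual ⇒ `BalabanLadder.IR` BY NAME (PROVED, E discharged, no X).** -/
theorem ir_of_typChainSharpSC (h : TypChainSharpSC) (hN : SharpOnset.IRNSC) :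
    Summit.QuantumFields.YangMills.Theses.BalabanLadder.IR :=
  SharpOnset.ir_of_onsetSharpSC (onsetSharpUKPcSC_of_typChainSharpSC h) hN


/-! ## §2 The own-plaquette guard (cell-local premise) and `TypChain` under it -/
section OwnGuard

variable {G : Type} [Group G] {N : ℕ} (ρ : G →* Matrix (Fin N) (Fin N) ℂ)

open Summit.QuantumFields.YangMills.Cruxes.IR.Tempered (cellEdges)
open Summit.QuantumFields.YangMills.Theorems.OddTorusChessboard (cellPlaqs plaqAction)

/-- **Insertion tolerance with the OWN-PLAQUETTE guard** (cplan g18's located caveat): as `InsertionTolerant`, but cleanliness is asked only of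
the cell's OWN plaquettes (`cellPlaqs w c`, all four edges in the cell) near `P` — a premise read off `cellEdges w c`.  Since a touching-clean
neighbourhood is own-clean, this is the STRONGER property (`InsertionTolerant.of_own`); a hull built with this guard stays `TypLocal`. -/
def InsertionTolerantOwn (w : Fin 4 → ℤ → ℤ) (θ : ℝ) (R ℓ₀ : ℕ) (Typ : (Fin 4 → ℤ) → Set (LGConfig 4 G)) : Prop :=
  ∀ (c : Fin 4 → ℤ), ∀ U ∈ Typ c, ∀ P : Finset (ZdEdge 4), P ⊆ cellEdges w c → P.card ≤ ℓ₀ →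
    (∀ q ∈ cellPlaqs w c, q ∈ plaquettesTouching (nearLinks w c P R) → plaqAction ρ q U ≤ θ) →
      ∀ V : LGConfig 4 G, (∀ e, e ∉ P → V e = U e) → V ∈ Typ c

variable {ρ}

/-- Own-guard tolerance implies the tolerance of record (the touching guard asks more cleanliness, so its premise is stronger). -/
theorem InsertionTolerant.of_own {w : Fin 4 → ℤ → ℤ} {θ : ℝ} {R ℓ₀ : ℕ} {Typ : (Fin 4 → ℤ) → Set (LGConfig 4 G)}
    (h : InsertionTolerantOwn ρ w θ R ℓ₀ Typ) : InsertionTolerant ρ w θ R ℓ₀ Typ :=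
  fun c U hU P hP hcard hclean V hV => h c U hU P hP hcard (fun q _ hq => hclean q hq) V hV

/-- **`TypChain` passes the own-guard test too (PROVED; same constants as `insertionTolerant_typChain`).**  The tolerance proof only ever
uses cleanliness of CHAIN plaquettes, which are own plaquettes of the cell. -/
theorem insertionTolerantOwn_typChain {θg θb : ℝ} (hθ : θg < θb) (w : Fin 4 → ℤ → ℤ) {R ℓ₀ ℓ₁ : ℕ} (hR : 3 ≤ R)
    (hℓ : 60 * ℓ₁ ≤ ℓ₀) : InsertionTolerantOwn ρ w θg R ℓ₁ (TypChain ρ θb w ℓ₀) := by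
  classical
  intro c₀ U hU P hP hcard hclean V hV
  rintro ⟨k, ch, hin, hbad, hstep, hext⟩
  let touches : Fin (k + 1) → Prop := fun i => (plaquetteEdges (ch i) ∩ P).Nonempty
  have hin' : ∀ i, ch i ∈ cellPlaqs w c₀ := fun i => Finset.mem_coe.1 (hin i)
  have hprop : ∀ i j : Fin (k + 1), touches i → supNormZ4 ((ch i).1 - (ch j).1) ≤ 2 → touches j := by
    intro i j hi hd
    by_contra hj
    have hguard : ch j ∈ plaquettesTouching (nearLinks w c₀ P R) := mem_guard_of_near_touching hR hi (hin' j) hd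
    have h1 : plaqAction ρ (ch j) U ≤ θg := hclean _ (hin' j) hguard
    have h2 : plaqAction ρ (ch j) V = plaqAction ρ (ch j) U := plaqAction_eq_of_not_touching ρ hV hj
    have h3 : θb ≤ plaqAction ρ (ch j) V := hbad j
    rw [h2] at h3
    exact absurd (h3.trans h1) (not_le.2 hθ)
  by_cases hex : ∃ i, touches i
  · obtain ⟨i₀, hi₀⟩ := hex
    have hdown : ∀ d : ℕ, ∀ i : Fin (k + 1), i.val + d = i₀.val → touches i := by
      intro d
      induction d with
      | zero =>
        intro i hi
        have : i = i₀ := Fin.ext (by omega)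
        rw [this]; exact hi₀
      | succ d ih =>
        intro i hi
        have hlt : i.val < k := by omega
        have hj := ih ⟨i.val + 1, by omega⟩ (by simp only; omega)
        have hs := hstep ⟨i.val, hlt⟩
        have e1 : (⟨i.val, hlt⟩ : Fin k).castSucc = i := Fin.ext rfl
        have e2 : (⟨i.val, hlt⟩ : Fin k).succ = ⟨i.val + 1, by omega⟩ := Fin.ext rfl
        rw [e1, e2] at hs
        rw [supNormZ4_sub_comm] at hs
        exact hprop _ _ hj hs
    have h0 : touches 0 := hdown i₀.val 0 (by simp)
    have hall : ∀ n : ℕ, ∀ i : Fin (k + 1), i.val = n → touches i := by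
      intro n
      induction n with
      | zero => intro i hi; have : i = 0 := Fin.ext hi; rw [this]; exact h0
      | succ n ih =>
        intro i hi
        have hlt : n < k := by omega
        have hprev := ih ⟨n, by omega⟩ rfl
        have hs := hstep ⟨n, hlt⟩
        have e1 : (⟨n, hlt⟩ : Fin k).castSucc = ⟨n, by omega⟩ := Fin.ext rfl
        have e2 : (⟨n, hlt⟩ : Fin k).succ = i := Fin.ext (by simp [hi])
        rw [e1, e2] at hs
        exact hprop _ _ hprev hs
    have htouch : ∀ i, ch i ∈ plaquettesTouching P := fun i =>
      mem_plaquettesTouching_iff.2 (hall i.val i rfl)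
    obtain ⟨K, c', hinj, hQ, -, hD⟩ := exists_injective_chain (Q := fun q => q ∈ plaquettesTouching P) ch htouch hstep hext
    have hcardK : K + 1 ≤ (plaquettesTouching P).card := by
      have hi : Function.Injective (fun i : Fin (K + 1) => (⟨c' i, hQ i⟩ : ↥(plaquettesTouching P))) :=
        fun s t hst => hinj (by simpa using congrArg Subtype.val hst)
      have := Fintype.card_le_of_injective _ hi
      simpa [Fintype.card_coe] using this
    have h30 : (plaquettesTouching P).card ≤ 30 * P.card := by
      have h := Literature.MathematicalPhysics.QuantumLattice.card_plaquettesTouching_le P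
      have h6 : Fintype.card {p : Fin 4 × Fin 4 // p.1 < p.2} = 6 := by decide
      rw [h6] at h
      omega
    have : 30 * P.card ≤ 30 * ℓ₁ := Nat.mul_le_mul_left _ hcard
    omega
  · simp only [not_exists] at hex
    refine hU ⟨k, ch, hin, fun i => ?_, hstep, hext⟩
    rw [← plaqAction_eq_of_not_touching ρ hV (hex i)]
    exact hbad i

/-- The own-guard premise is CELL-LOCAL: it reads `U` only through `cellEdges w c` (own plaquettes have their four edges in the cell). -/
theorem ownGuard_iff_of_agree {w : Fin 4 → ℤ → ℤ} {c : Fin 4 → ℤ} {P : Finset (ZdEdge 4)} {R : ℕ} {θ : ℝ}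
    {U U' : LGConfig 4 G} (hUU' : ∀ e ∈ (↑(cellEdges w c) : Set (ZdEdge 4)), U e = U' e) :
    (∀ q ∈ cellPlaqs w c, q ∈ plaquettesTouching (nearLinks w c P R) → plaqAction ρ q U ≤ θ) ↔
      (∀ q ∈ cellPlaqs w c, q ∈ plaquettesTouching (nearLinks w c P R) → plaqAction ρ q U' ≤ θ) := by
  refine forall_congr' fun q => forall_congr' fun hq => forall_congr' fun _ => ?_
  rw [Summit.QuantumFields.YangMills.Theorems.OddTorusChessboard.plaqAction_congr ρ q fun e he =>
    hUU' e (Finset.mem_coe.2 (Summit.QuantumFields.YangMills.Theorems.OddTorusChessboard.plaquetteEdges_subset_of_mem_cellPlaqs hq he))]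

end OwnGuard

end Summit.QuantumFields.YangMills.Cruxes.IR.AfPincerUc.SharpLanes

end
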